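import Literature.Analysis.FluidPDE.GIPRemainderWindowInequality
import Literature.Analysis.FluidPDE.KatoRemainderL3
import Literature.Analysis.FluidPDE.KatoCaloricField
import Literature.Analysis.FluidPDE.KochTataruFixedPoint
import HarnessLib

/-!
# The window energy inequality of the caloric remainder of a Kato solution (Kato setting)

Analysis/FluidPDE support file (theorems only) on the discharge path of
`Literature.Analysis.FluidPDE.GIP2003_L3_stability` (GIP 2003, Thm. 0.1 (i)): the energy
inequality of the remainder `v = w - e` of a Kato solution after subtracting the caloric
background `e(τ) = e^{ντΔ}ũ₀` of a bounded representative `ũ₀` of its `L³` datum, on a time window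
`[a, b]` on which `‖e(τ)‖₃` is small (GIP, proof of Thm. 2.1, (8)).

* `GIP2003.caloric_isSmoothSpaceTimeOn`, `…_timeDeriv`, `…_isDivFree` — smoothness, heat equation
  in `timeDeriv` form and divergence-freeness of `e` on the open strip;
* `GIP2003.eLpNorm_inner_gradient_cutoff_sq_le` — `‖⟪V, ∇χ_R²⟫‖₃ ≤ (2C₁/R)‖V‖₃`;
* `GIP2003.kato_window_inequality_cutoff` — the hypotheses of
  `GIP2003.classical_window_inequality` are derived for the classical representative `(w, π)` of
  the Kato solution (pressure through Stein's bound `GIP2003.ae_enorm_pressure_pairing_le`): the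
  cut-off window inequality for every `R ≥ 1` with a constant `C/R`;
* `GIP2003.kato_remainder_window_inequality` — the limit `R → ∞` (Fatou for the energy at time `b`
  and for the dissipation, `χ_R ≤ 1` for the energy at time `a`):
  `‖v(b)‖₂² + ν∫_a^b‖Dv‖₂² ≤ ‖v(a)‖₂² + (4/ν)∫_a^b‖e‖₄⁴` in `ℝ≥0∞`.

## References

* I. Gallagher, D. Iftimie, F. Planchon, Ann. Inst. Fourier 53 (2003), proof of Thm. 2.1,
  (8), p. 1397. [GallagherIftimiePlanchon2003]
-/

noncomputable section

open MeasureTheory TopologicalSpace Set Function Filter Metric InnerProductSpace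
open _root_.Topology
open scoped ENNReal NNReal RealInnerProductSpace Laplacian

namespace Literature.Analysis.FluidPDE

namespace GIP2003

section Caloric

variable {E : Type*} [NormedAddCommGroup E] [InnerProductSpace ℝ E] [FiniteDimensional ℝ E]
  [MeasurableSpace E] [BorelSpace E]

/-- The caloric background `e(t) = e^{νtΔ}ũ₀` of an `L³` datum is jointly smooth on every open
strip `(0, T)` (`contDiffOn_uncurry_heatFlow`). [folklore] -/
theorem caloric_isSmoothSpaceTimeOn {ũ₀ : E → E} (hũ₀ : MemLp ũ₀ 3 volume) {ν : ℝ} (hν : 0 < ν)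
    (T : ℝ) : IsSmoothSpaceTimeOn (Ioo 0 T) fun t x => heatFlow ũ₀ (ν * t) x :=
  (contDiffOn_uncurry_heatFlow hũ₀ (by norm_num) hν).mono
    (prod_mono Ioo_subset_Ioi_self Subset.rfl)

/-- The heat equation for the caloric background in `timeDeriv` form on `(0, T)`
(`hasDerivAt_heatFlow_time`). [folklore] -/
theorem caloric_timeDeriv {ũ₀ : E → E} (hũ₀ : MemLp ũ₀ 3 volume) {ν : ℝ} (hν : 0 < ν) {T t : ℝ}
    (ht : t ∈ Ioo 0 T) (x : E) :
    timeDeriv (fun s y => heatFlow ũ₀ (ν * s) y) t x = ν • (Δ (fun y => heatFlow ũ₀ (ν * t) y)) x := by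
  rw [timeDeriv_apply]
  exact (hasDerivAt_heatFlow_time hũ₀ (by norm_num) hν ht.1 x).deriv

/-- The caloric background of a weakly divergence-free `L³` datum is classically divergence free
at positive times (`isDivFree_heatFlow_of_pos`). [folklore] -/
theorem caloric_isDivFree {ũ₀ : E → E} (hũ₀ : MemLp ũ₀ 3 volume) (hdiv : IsWeaklyDivFree ũ₀)
    {ν : ℝ} (hν : 0 < ν) {T t : ℝ} (ht : t ∈ Ioo 0 T) :
    VectorCalculus.IsDivFree (fun y => heatFlow ũ₀ (ν * t) y) :=
  isDivFree_heatFlow_of_pos hdiv hũ₀ (by norm_num) (mul_pos hν ht.1)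

/-- `‖⟪V, ∇χ_R²⟫‖₃ ≤ (2C₁/R) ‖V‖₃` (pointwise `|⟪V, ∇χ_R²⟫| ≤ (2C₁/R)|V|`). [folklore] -/
theorem eLpNorm_inner_gradient_cutoff_sq_le {V : E → E} {R C₁ : ℝ}
    (hC₁ : ∀ x : E, ‖fderiv ℝ (cutoff R) x‖ ≤ C₁ / R) :
    eLpNorm (fun x => ⟪V x, gradient (fun y : E => cutoff R y ^ 2) x⟫) 3 volume ≤
      ENNReal.ofReal (2 * (C₁ / R)) * eLpNorm V 3 volume := by
  have hk : 0 ≤ 2 * (C₁ / R) := by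
    have := le_trans (norm_nonneg _) (hC₁ 0); positivity
  have hpt : ∀ x, ‖⟪V x, gradient (fun y : E => cutoff R y ^ 2) x⟫‖ ≤ 2 * (C₁ / R) * ‖V x‖ := by
    intro x
    rw [Real.norm_eq_abs]
    calc |⟪V x, gradient (fun y : E => cutoff R y ^ 2) x⟫|
        ≤ ‖V x‖ * ‖gradient (fun y : E => cutoff R y ^ 2) x‖ := abs_real_inner_le_norm _ _
      _ ≤ ‖V x‖ * (2 * (C₁ / R)) := by gcongr; exact norm_gradient_cutoff_sq_le hC₁ x
      _ = 2 * (C₁ / R) * ‖V x‖ := by ring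
  calc eLpNorm (fun x => ⟪V x, gradient (fun y : E => cutoff R y ^ 2) x⟫) 3 volume
      ≤ eLpNorm (fun x => (2 * (C₁ / R)) • V x) 3 volume := by
        refine eLpNorm_mono fun x => ?_
        rw [norm_smul, Real.norm_of_nonneg hk]
        exact hpt x
    _ = ENNReal.ofReal (2 * (C₁ / R)) * eLpNorm V 3 volume := by
        rw [show (fun x => (2 * (C₁ / R)) • V x) = (2 * (C₁ / R)) • V from rfl, eLpNorm_const_smul,
          Real.enorm_eq_ofReal hk]

end Caloric

/-! ### The cut-off window inequality for a Kato solution -/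

section Kato

variable {T ν : ℝ} {u₀ ũ₀ : EuclideanSpace ℝ (Fin 3) → EuclideanSpace ℝ (Fin 3)}
  {u w : ℝ → EuclideanSpace ℝ (Fin 3) → EuclideanSpace ℝ (Fin 3)}
  {π : ℝ → EuclideanSpace ℝ (Fin 3) → ℝ}

/-- `L³ ∩ L^∞ ⊂ L⁴`, quantitatively: if `|f| ≤ M` and `f ∈ L³` then `∫ |f|⁴ ≤ M ‖f‖₃³` (as a
lintegral bound) and `f ∈ L⁴`. [folklore] -/
theorem lintegral_enorm_pow_four_le_of_bound {f : EuclideanSpace ℝ (Fin 3) → EuclideanSpace ℝ (Fin 3)}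
    (hf : MemLp f 3 volume) {M : ℝ} (hM : ∀ x, ‖f x‖ ≤ M) :
    ∫⁻ x, ‖f x‖ₑ ^ (4 : ℝ) ≤ ENNReal.ofReal M * eLpNorm f 3 volume ^ (3 : ℝ) ∧ MemLp f 4 volume := by
  have hpt : ∀ x, ‖f x‖ₑ ^ (4 : ℝ) ≤ ENNReal.ofReal M * ‖f x‖ₑ ^ (3 : ℝ) := by
    intro x
    rw [show (4 : ℝ) = 1 + 3 by norm_num, ENNReal.rpow_add_of_nonneg _ _ (by norm_num) (by norm_num),
      ENNReal.rpow_one]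
    gcongr
    rw [← ofReal_norm]
    exact ENNReal.ofReal_le_ofReal (hM x)
  have h1 : ∫⁻ x, ‖f x‖ₑ ^ (4 : ℝ) ≤ ENNReal.ofReal M * eLpNorm f 3 volume ^ (3 : ℝ) := by
    calc ∫⁻ x, ‖f x‖ₑ ^ (4 : ℝ) ≤ ∫⁻ x, ENNReal.ofReal M * ‖f x‖ₑ ^ (3 : ℝ) := lintegral_mono hpt
      _ = ENNReal.ofReal M * ∫⁻ x, ‖f x‖ₑ ^ (3 : ℝ) := by
          rw [lintegral_const_mul' _ _ ENNReal.ofReal_ne_top]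
      _ = ENNReal.ofReal M * eLpNorm f 3 volume ^ (3 : ℝ) := by rw [lintegral_enorm_rpow_three_eq]
  refine ⟨h1, hf.1, ?_⟩
  have hlt : ∫⁻ x, ‖f x‖ₑ ^ (4 : ℝ) < ⊤ :=
    h1.trans_lt (ENNReal.mul_lt_top ENNReal.ofReal_lt_top
      (ENNReal.rpow_lt_top_of_nonneg (by norm_num) hf.eLpNorm_ne_top))
  have h := (eLpNorm_lt_top_iff_lintegral_rpow_enorm_lt_top (p := (4 : ℝ≥0∞)) (by norm_num) (by norm_num)
    (f := f) (μ := volume)).2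
  simp only [ENNReal.toReal_ofNat] at h
  exact h hlt

/-- The classical velocity minus a smooth field has divergence-free slices when both have.
[folklore] -/
theorem isDivFree_sub_slice {V₁ V₂ : ℝ → EuclideanSpace ℝ (Fin 3) → EuclideanSpace ℝ (Fin 3)} {S : Set ℝ}
    (h₁ : IsSmoothSpaceTimeOn S V₁) (h₂ : IsSmoothSpaceTimeOn S V₂)
    (hd₁ : ∀ t ∈ S, VectorCalculus.IsDivFree (V₁ t)) (hd₂ : ∀ t ∈ S, VectorCalculus.IsDivFree (V₂ t))
    {t : ℝ} (ht : t ∈ S) : VectorCalculus.IsDivFree fun y => V₁ t y - V₂ t y := by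
  intro x
  have hd1 : DifferentiableAt ℝ (V₁ t) x :=
    ((h₁.contDiff_slice ht).differentiable (by simp)).differentiableAt
  have hd2 : DifferentiableAt ℝ (V₂ t) x :=
    ((h₂.contDiff_slice ht).differentiable (by simp)).differentiableAt
  have h1 : VectorCalculus.divergence (fun y => V₁ t y - V₂ t y) x =
      VectorCalculus.divergence (V₁ t) x - VectorCalculus.divergence (V₂ t) x := by
    simp only [VectorCalculus.divergence, fderiv_fun_sub hd1 hd2,
      ContinuousLinearMap.toLinearMap_sub, map_sub]
  rw [h1, hd₁ t ht x, hd₂ t ht x, sub_zero]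

/-- **The cut-off window inequality for the caloric remainder of a Kato solution** (GIP 2003,
proof of Thm. 2.1, (8) integrated on `[a, b]`, p. 1397; the pressure term through Stein's bound
for the Riesz pressure, `GIP2003.ae_enorm_pressure_pairing_le`). Let `u` be a Kato solution on
`[0, T)` (`ν > 0`) with datum a.e. equal to a bounded `ũ₀`, `(w, π)` its classical representative
on the open strip, `e(τ) = e^{ντΔ}ũ₀`, `0 < a ≤ b < T`, and assume the smallness
`2√2 K ‖e(τ)‖₃ ≤ ν/4` on `[a, b]`. Then there is `C` such that for every `R ≥ 1`
`∫χ_R²|v(b)|² + ν∫_a^b∫χ_R²|Dv|² ≤ ∫χ_R²|v(a)|² + (4/ν)∫_a^b∫|e|⁴ + C/R`, `v = w - e`.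
[cite: GallagherIftimiePlanchon2003, Thm. 2.1 (proof, (8), p. 1397)] -/
theorem kato_window_inequality_cutoff (hν : 0 < ν) (hu : IsKatoSolutionOn T ν u₀ u)
    (hae₀ : u₀ =ᵐ[volume] ũ₀) {M : ℝ} (hMb : ∀ x, ‖ũ₀ x‖ ≤ M)
    (hcl : IsClassicalNSSolutionOn (Ioo 0 T) ν 0 w π) (hwu : ∀ t ∈ Ioo 0 T, w t =ᵐ[volume] u t)
    {a b : ℝ} (ha : 0 < a) (hab : a ≤ b) (hbT : b < T)
    (hsmall : ∀ τ ∈ Icc a b, 2 * Real.sqrt 2 *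
      (eLpNormLESNormFDerivOfEqInnerConst (volume : Measure (EuclideanSpace ℝ (Fin 3))) 2 : ℝ) *
        (eLpNorm (heatFlow ũ₀ (ν * τ)) 3 volume).toReal ≤ ν / 4) :
    ∃ C : ℝ, ∀ R : ℝ, 1 ≤ R →
      (∫ x, cutoff R x ^ 2 * ‖w b x - heatFlow ũ₀ (ν * b) x‖ ^ 2) +
          ν * ∫ τ in Ioo a b, ∫ x, cutoff R x ^ 2 *
            frobeniusNormSq (fderiv ℝ (fun y => w τ y - heatFlow ũ₀ (ν * τ) y) x) ≤
        (∫ x, cutoff R x ^ 2 * ‖w a x - heatFlow ũ₀ (ν * a) x‖ ^ 2) +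
          4 / ν * (∫ τ in Ioo a b, ∫ x, ‖heatFlow ũ₀ (ν * τ) x‖ ^ 4) + C / R := by
  have hT : 0 < T := ha.trans (hab.trans_lt hbT)
  have hE3 : Module.finrank ℝ (EuclideanSpace ℝ (Fin 3)) = 3 := finrank_euclideanSpace_fin
  set bs := stdOrthonormalBasis ℝ (EuclideanSpace ℝ (Fin 3)) with hbs
  -- the datum
  have hũ₀3 : MemLp ũ₀ 3 volume := (hu.memLp_initial hT).ae_eq hae₀
  have hdiv₀ : IsWeaklyDivFree ũ₀ := (hu.isWeaklyDivFree_initial hT).congr_ae hae₀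
  have h13 : (1 : ℝ≥0∞) ≤ 3 := by norm_num
  -- the caloric background
  set e : ℝ → EuclideanSpace ℝ (Fin 3) → EuclideanSpace ℝ (Fin 3) := fun t x => heatFlow ũ₀ (ν * t) x with hedef
  have he : IsSmoothSpaceTimeOn (Ioo 0 T) e := caloric_isSmoothSpaceTimeOn hũ₀3 hν T
  have hheat : ∀ t ∈ Ioo 0 T, ∀ x, timeDeriv e t x = ν • (Δ (e t)) x := fun t ht x =>
    caloric_timeDeriv hũ₀3 hν ht x
  have hdive : ∀ t ∈ Ioo 0 T, VectorCalculus.IsDivFree (e t) := fun t ht =>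
    caloric_isDivFree hũ₀3 hdiv₀ hν ht
  have he3 : ∀ t, 0 ≤ t → MemLp (e t) 3 volume := fun t ht =>
    memLp_heatFlow_holds hũ₀3 h13 (by positivity)
  have he3le : ∀ t, 0 ≤ t → eLpNorm (e t) 3 volume ≤ eLpNorm ũ₀ 3 volume := fun t ht =>
    eLpNorm_heatFlow_le_holds hũ₀3 h13 (by positivity)
  have hebd : ∀ t x, ‖e t x‖ ≤ M := fun t x => norm_heatFlow_le_of_bound hMb _ x
  -- the bound `Λ`
  obtain ⟨Mu, hMu⟩ := hu.exists_forall_eLpNorm_three_le hbT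
  set N0 : ℝ := (eLpNorm ũ₀ 3 volume).toReal with hN0
  set Λ : ℝ := (Mu : ℝ) + N0 with hΛdef
  have hN00 : 0 ≤ N0 := ENNReal.toReal_nonneg
  have hΛ0 : 0 ≤ Λ := by positivity
  have hIcc : ∀ τ ∈ Icc a b, τ ∈ Ioo 0 T := fun τ hτ => ⟨ha.trans_le hτ.1, hτ.2.trans_lt hbT⟩
  have hw3 : ∀ τ ∈ Icc a b, MemLp (w τ) 3 volume ∧ (eLpNorm (w τ) 3 volume).toReal ≤ Λ := by
    intro τ hτ
    have hτ0 : τ ∈ Icc 0 b := ⟨(ha.trans_le hτ.1).le, hτ.2⟩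
    have hmem : MemLp (u τ) 3 volume := hu.memLp ⟨hτ0.1, hτ.2.trans_lt hbT⟩
    have hae := hwu τ (hIcc τ hτ)
    refine ⟨hmem.ae_eq hae.symm, ?_⟩
    rw [eLpNorm_congr_ae hae]
    calc (eLpNorm (u τ) 3 volume).toReal ≤ (Mu : ℝ) := by
          have h := hMu τ hτ0
          exact (ENNReal.toReal_mono ENNReal.coe_ne_top h).trans (by simp)
      _ ≤ Λ := by rw [hΛdef]; linarith
  have he3' : ∀ τ ∈ Icc a b, MemLp (e τ) 3 volume ∧ (eLpNorm (e τ) 3 volume).toReal ≤ Λ := by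
    intro τ hτ
    have hτ0 : 0 ≤ τ := (ha.trans_le hτ.1).le
    refine ⟨he3 τ hτ0, ?_⟩
    calc (eLpNorm (e τ) 3 volume).toReal ≤ N0 :=
          ENNReal.toReal_mono hũ₀3.eLpNorm_ne_top (he3le τ hτ0)
      _ ≤ Λ := by rw [hΛdef]; linarith [NNReal.coe_nonneg Mu]
  have hv3 : ∀ τ ∈ Icc a b, MemLp (fun x => w τ x - e τ x) 3 volume ∧
      (eLpNorm (fun x => w τ x - e τ x) 3 volume).toReal ≤ Λ := by
    intro τ hτ
    obtain ⟨hwm, hwle⟩ := hw3 τ hτ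
    obtain ⟨hem, hele⟩ := he3' τ hτ
    refine ⟨hwm.sub hem, ?_⟩
    have hsub : eLpNorm (fun x => w τ x - e τ x) 3 volume ≤ eLpNorm (w τ) 3 volume + eLpNorm (e τ) 3 volume :=
      eLpNorm_sub_le hwm.1 hem.1 h13
    have hτ0 : 0 ≤ τ := (ha.trans_le hτ.1).le
    calc (eLpNorm (fun x => w τ x - e τ x) 3 volume).toReal
        ≤ (eLpNorm (w τ) 3 volume + eLpNorm (e τ) 3 volume).toReal :=
          ENNReal.toReal_mono (ENNReal.add_ne_top.2 ⟨hwm.eLpNorm_ne_top, hem.eLpNorm_ne_top⟩) hsub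
      _ = (eLpNorm (w τ) 3 volume).toReal + (eLpNorm (e τ) 3 volume).toReal :=
          ENNReal.toReal_add hwm.eLpNorm_ne_top hem.eLpNorm_ne_top
      _ ≤ (Mu : ℝ) + N0 := by
          refine add_le_add ?_ (ENNReal.toReal_mono hũ₀3.eLpNorm_ne_top (he3le τ hτ0))
          have hτ0' : τ ∈ Icc 0 b := ⟨hτ0, hτ.2⟩
          rw [eLpNorm_congr_ae (hwu τ (hIcc τ hτ))]
          exact (ENNReal.toReal_mono ENNReal.coe_ne_top (hMu τ hτ0')).trans (by simp)
      _ = Λ := rfl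
  -- `e ∈ L⁴` with a uniform bound, and integrability of `τ ↦ ∫|e|⁴`
  have he4 : ∀ τ ∈ Icc a b, MemLp (e τ) 4 volume := fun τ hτ =>
    (lintegral_enorm_pow_four_le_of_bound (he3 τ (ha.trans_le hτ.1).le) (hebd τ)).2
  have hE4 : IntegrableOn (fun τ => ∫ x, ‖e τ x‖ ^ 4) (Ioo a b) volume := by
    have hG : ContinuousOn (fun z : ℝ × EuclideanSpace ℝ (Fin 3) => ‖e z.1 z.2‖ ^ 4) (Icc a b ×ˢ univ) :=
      (he.continuousOn.mono (prod_mono (fun τ hτ => hIcc τ hτ) Subset.rfl)).norm.pow 4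
    have hfin : ∫⁻ t in Ioo a b, ∫⁻ x, ‖(fun z : ℝ × EuclideanSpace ℝ (Fin 3) => ‖e z.1 z.2‖ ^ 4) (t, x)‖ₑ < ⊤ := by
      have hinner : ∀ t ∈ Ioo a b, ∫⁻ x, ‖(fun z : ℝ × EuclideanSpace ℝ (Fin 3) => ‖e z.1 z.2‖ ^ 4) (t, x)‖ₑ ≤
          ENNReal.ofReal M * eLpNorm ũ₀ 3 volume ^ (3 : ℝ) := by
        intro t ht
        have ht0 : 0 ≤ t := (ha.trans ht.1).le
        have h := (lintegral_enorm_pow_four_le_of_bound (he3 t ht0) (hebd t)).1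
        have heq : ∫⁻ x, ‖(fun z : ℝ × EuclideanSpace ℝ (Fin 3) => ‖e z.1 z.2‖ ^ 4) (t, x)‖ₑ = ∫⁻ x, ‖e t x‖ₑ ^ (4 : ℝ) := by
          refine lintegral_congr fun x => ?_
          simp only
          rw [Real.enorm_eq_ofReal (by positivity), ← ofReal_norm, ENNReal.ofReal_rpow_of_nonneg (norm_nonneg _) (by norm_num)]
          norm_num
        rw [heq]
        exact h.trans (mul_le_mul' le_rfl (ENNReal.rpow_le_rpow (he3le t ht0) (by norm_num)))
      calc ∫⁻ t in Ioo a b, ∫⁻ x, ‖(fun z : ℝ × EuclideanSpace ℝ (Fin 3) => ‖e z.1 z.2‖ ^ 4) (t, x)‖ₑ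
          ≤ ∫⁻ t in Ioo a b, ENNReal.ofReal M * eLpNorm ũ₀ 3 volume ^ (3 : ℝ) :=
            setLIntegral_mono' measurableSet_Ioo hinner
        _ = ENNReal.ofReal M * eLpNorm ũ₀ 3 volume ^ (3 : ℝ) * volume (Ioo a b) := setLIntegral_const _ _
        _ < ⊤ := ENNReal.mul_lt_top (ENNReal.mul_lt_top ENNReal.ofReal_lt_top
            (ENNReal.rpow_lt_top_of_nonneg (by norm_num) hũ₀3.eLpNorm_ne_top)) measure_Ioo_lt_top
    have hI := integrable_prod_of_continuousOn_of_lintegral hG hfin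
    exact hI.integral_prod_left
  -- the cutoff constant
  obtain ⟨C₁, hC₁0, hC₁⟩ := exists_norm_fderiv_cutoff_le (E := EuclideanSpace ℝ (Fin 3))
  -- the pressure constant
  set S' : ℝ := (b + T) / 2 with hS'
  have hbS' : b < S' := by rw [hS']; linarith
  have hS'T : S' < T := by rw [hS']; linarith
  have hS'0 : 0 < S' := (ha.trans_le hab).trans hbS'
  have hV : IsSmoothSpaceTimeOn (Ioo 0 T) fun t x => w t x - e t x := hcl.smooth_velocity.sub he
  have hdivV : ∀ t ∈ Ioo 0 T, VectorCalculus.IsDivFree fun y => w t y - e t y := fun t ht =>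
    isDivFree_sub_slice hcl.smooth_velocity he hcl.divFree hdive ht
  set P₀ : ℝ := (steinConstThreeHalves : ℝ) * (Mu : ℝ) ^ 2 * (2 * C₁) * Λ with hP₀
  have hP₀0 : 0 ≤ P₀ := by positivity
  -- the constant
  set Err : ℝ := 10 * C₁ * Λ ^ 3 +
      32 * ν * C₁ ^ 2 * ((volume (closedBall (0 : EuclideanSpace ℝ (Fin 3)) 1)) ^ (1 / 3 : ℝ)).toReal * Λ ^ 2 +
      16 / ν * (eLpNormLESNormFDerivOfEqInnerConst (volume : Measure (EuclideanSpace ℝ (Fin 3))) 2 : ℝ) ^ 2 *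
        C₁ ^ 2 * ((volume (closedBall (0 : EuclideanSpace ℝ (Fin 3)) 1)) ^ (1 / 3 : ℝ)).toReal * Λ ^ 4 with hErr
  refine ⟨(b - a) * (Err + 2 * P₀), fun R hR => ?_⟩
  have hR0 : 0 < R := one_pos.trans_le hR
  -- the pressure bound for this `R`, a.e. on `(a, b)`
  have hP : ∀ᵐ τ ∂((volume : Measure ℝ).restrict (Ioo a b)),
      |∫ x, π τ x * ⟪w τ x - e τ x, gradient (fun y : EuclideanSpace ℝ (Fin 3) => cutoff R y ^ 2) x⟫| ≤ P₀ / R := by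
    have hφ : ContDiff ℝ (⊤ : ℕ∞) fun y : EuclideanSpace ℝ (Fin 3) => cutoff R y ^ 2 := contDiff_cutoff_sq R
    have hφc : HasCompactSupport fun y : EuclideanSpace ℝ (Fin 3) => cutoff R y ^ 2 := hasCompactSupport_cutoff_sq hR0
    have hae := ae_enorm_pressure_pairing_le hν hu hS'0 hS'T hcl hwu hV hdivV hφ hφc
    have hae' : ∀ᵐ τ ∂((volume : Measure ℝ).restrict (Ioo a b)),
        ‖∫ x, π τ x * ⟪w τ x - e τ x, gradient (fun y : EuclideanSpace ℝ (Fin 3) => cutoff R y ^ 2) x⟫‖ₑ ≤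
          steinConstThreeHalves * eLpNorm (u τ) 3 volume ^ 2 *
            eLpNorm (fun x => ⟪w τ x - e τ x, gradient (fun y : EuclideanSpace ℝ (Fin 3) => cutoff R y ^ 2) x⟫) 3 volume :=
      ae_restrict_of_ae_restrict_of_subset (Ioo_subset_Ioo ha.le hbS'.le) hae
    filter_upwards [hae', ae_restrict_mem measurableSet_Ioo] with τ hτ hτm
    have hτI : τ ∈ Icc a b := Ioo_subset_Icc_self hτm
    have hτ0 : τ ∈ Icc 0 b := ⟨(ha.trans hτm.1).le, hτm.2.le⟩
    have hg := eLpNorm_inner_gradient_cutoff_sq_le (V := fun x => w τ x - e τ x) (hC₁ R hR0)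
    have hu3 : eLpNorm (u τ) 3 volume ≤ Mu := hMu τ hτ0
    have hv3' : eLpNorm (fun x => w τ x - e τ x) 3 volume ≤ ENNReal.ofReal Λ := by
      rw [← ENNReal.ofReal_toReal (hv3 τ hτI).1.eLpNorm_ne_top]
      exact ENNReal.ofReal_le_ofReal (hv3 τ hτI).2
    have hbound : ‖∫ x, π τ x * ⟪w τ x - e τ x, gradient (fun y : EuclideanSpace ℝ (Fin 3) => cutoff R y ^ 2) x⟫‖ₑ ≤
        ENNReal.ofReal (P₀ / R) := by
      calc ‖∫ x, π τ x * ⟪w τ x - e τ x, gradient (fun y : EuclideanSpace ℝ (Fin 3) => cutoff R y ^ 2) x⟫‖ₑ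
          ≤ steinConstThreeHalves * eLpNorm (u τ) 3 volume ^ 2 *
              eLpNorm (fun x => ⟪w τ x - e τ x, gradient (fun y : EuclideanSpace ℝ (Fin 3) => cutoff R y ^ 2) x⟫) 3 volume := hτ
        _ ≤ steinConstThreeHalves * (Mu : ℝ≥0∞) ^ 2 * (ENNReal.ofReal (2 * (C₁ / R)) * ENNReal.ofReal Λ) := by
            gcongr
            exact hg.trans (mul_le_mul' le_rfl hv3')
        _ = ENNReal.ofReal (P₀ / R) := by
            rw [hP₀, ← ENNReal.ofReal_coe_nnreal, ← ENNReal.ofReal_coe_nnreal,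
              ← ENNReal.ofReal_pow (NNReal.coe_nonneg _), ← ENNReal.ofReal_mul (NNReal.coe_nonneg _),
              ← ENNReal.ofReal_mul (by positivity), ← ENNReal.ofReal_mul (by positivity)]
            congr 1
            field_simp
    have habs : ENNReal.ofReal |∫ x, π τ x * ⟪w τ x - e τ x, gradient (fun y : EuclideanSpace ℝ (Fin 3) => cutoff R y ^ 2) x⟫| ≤
        ENNReal.ofReal (P₀ / R) := by
      rwa [← Real.enorm_eq_ofReal_abs]
    exact (ENNReal.ofReal_le_ofReal_iff (by positivity)).1 habs
  -- apply the classical window inequality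
  have h := classical_window_inequality bs hE3 hcl hν he hheat hdive ha hab hbT hΛ0 hv3 he3' hw3 he4 hE4
    (fun τ hτ => hsmall τ hτ) hC₁ hR hP
  have hc : (b - a) * (Err / R + 2 * (P₀ / R)) = (b - a) * (Err + 2 * P₀) / R := by
    field_simp
  rw [hErr] at hc
  linarith [h, hc]

/-- Continuity in time of the cut-off dissipation `τ ↦ ∫ χ_R² |D(V τ)|²` of a jointly smooth field.
[folklore] -/
theorem continuousOn_cutoff_dissipation {V : ℝ → EuclideanSpace ℝ (Fin 3) → EuclideanSpace ℝ (Fin 3)}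
    {S : Set ℝ} (hV : IsSmoothSpaceTimeOn S V) (hS : UniqueDiffOn ℝ S) {a b : ℝ} (hI : Icc a b ⊆ S)
    {R : ℝ} (hR : 0 < R) :
    ContinuousOn (fun τ => ∫ x, cutoff R x ^ 2 * frobeniusNormSq (fderiv ℝ (V τ) x)) (Icc a b) := by
  have hsub : Icc a b ×ˢ (univ : Set (EuclideanSpace ℝ (Fin 3))) ⊆ S ×ˢ univ := prod_mono hI Subset.rfl
  have hfrob : Continuous fun L : EuclideanSpace ℝ (Fin 3) →L[ℝ] EuclideanSpace ℝ (Fin 3) =>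
      frobeniusNormSq L := by
    set bs := stdOrthonormalBasis ℝ (EuclideanSpace ℝ (Fin 3))
    have : (fun L : EuclideanSpace ℝ (Fin 3) →L[ℝ] EuclideanSpace ℝ (Fin 3) => frobeniusNormSq L) =
        fun L => ∑ i, ‖L (bs i)‖ ^ 2 := funext fun L => frobeniusNormSq_eq_sum bs L
    rw [this]
    exact continuous_finsetSum _ fun i _ =>
      ((ContinuousLinearMap.apply ℝ (EuclideanSpace ℝ (Fin 3)) (bs i)).continuous.norm).pow 2
  have hG : ContinuousOn (fun z : ℝ × EuclideanSpace ℝ (Fin 3) =>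
      frobeniusNormSq (fderiv ℝ (V z.1) z.2)) (Icc a b ×ˢ univ) :=
    hfrob.comp_continuousOn ((hV.fderiv_slice hS).continuousOn.mono hsub)
  exact continuousOn_integral_mul_of_continuousOn ((contDiff_cutoff (n := 1) R).continuous.pow 2)
    (hasCompactSupport_cutoff_sq hR) hG

/-- `ofReal ∫ f ≤ ∫⁻ ofReal f` for a.e. nonnegative `f` (no integrability needed). [folklore] -/
theorem ofReal_integral_le_lintegral_ofReal' {α : Type*} [MeasurableSpace α] {μ : Measure α}
    {f : α → ℝ} (hf : 0 ≤ᵐ[μ] f) :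
    ENNReal.ofReal (∫ x, f x ∂μ) ≤ ∫⁻ x, ENNReal.ofReal (f x) ∂μ := by
  by_cases hfi : Integrable f μ
  · rw [ofReal_integral_eq_lintegral_ofReal hfi hf]
  · rw [integral_undef hfi, ENNReal.ofReal_zero]
    exact zero_le

/-- **The window energy inequality for the caloric remainder of a Kato solution** (GIP 2003,
proof of Thm. 2.1, (8) integrated on `[a, b]`, p. 1397, in the limit of cutoffs `χ_R → 1`):
with the notation and hypotheses of `GIP2003.kato_window_inequality_cutoff`,
`‖v(b)‖₂² + ν ∫_a^b ‖Dv‖₂² ≤ ‖v(a)‖₂² + (4/ν) ∫_a^b ‖e‖₄⁴` (in `ℝ≥0∞`, `v = w - e`).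
[cite: GallagherIftimiePlanchon2003, Thm. 2.1 (proof, (8), p. 1397)] -/
theorem kato_remainder_window_inequality (hν : 0 < ν) (hu : IsKatoSolutionOn T ν u₀ u)
    (hae₀ : u₀ =ᵐ[volume] ũ₀) {M : ℝ} (hMb : ∀ x, ‖ũ₀ x‖ ≤ M)
    (hcl : IsClassicalNSSolutionOn (Ioo 0 T) ν 0 w π) (hwu : ∀ t ∈ Ioo 0 T, w t =ᵐ[volume] u t)
    {a b : ℝ} (ha : 0 < a) (hab : a ≤ b) (hbT : b < T)
    (hsmall : ∀ τ ∈ Icc a b, 2 * Real.sqrt 2 *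
      (eLpNormLESNormFDerivOfEqInnerConst (volume : Measure (EuclideanSpace ℝ (Fin 3))) 2 : ℝ) *
        (eLpNorm (heatFlow ũ₀ (ν * τ)) 3 volume).toReal ≤ ν / 4) :
    (∫⁻ x, ‖w b x - heatFlow ũ₀ (ν * b) x‖ₑ ^ 2) +
        ENNReal.ofReal ν * ∫⁻ τ in Ioo a b, ∫⁻ x,
          ENNReal.ofReal (frobeniusNormSq (fderiv ℝ (fun y => w τ y - heatFlow ũ₀ (ν * τ) y) x)) ≤
      (∫⁻ x, ‖w a x - heatFlow ũ₀ (ν * a) x‖ₑ ^ 2) +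
        ENNReal.ofReal (4 / ν) * ∫⁻ τ in Ioo a b, ∫⁻ x, ‖heatFlow ũ₀ (ν * τ) x‖ₑ ^ 4 := by
  obtain ⟨C, hC⟩ := kato_window_inequality_cutoff hν hu hae₀ hMb hcl hwu ha hab hbT hsmall
  have hT : 0 < T := ha.trans_le (hab.trans hbT.le)
  have hũ₀3 : MemLp ũ₀ 3 volume := (hu.memLp_initial hT).ae_eq hae₀
  set e : ℝ → EuclideanSpace ℝ (Fin 3) → EuclideanSpace ℝ (Fin 3) :=
    fun t x => heatFlow ũ₀ (ν * t) x with hedef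
  have he : IsSmoothSpaceTimeOn (Ioo 0 T) e := caloric_isSmoothSpaceTimeOn hũ₀3 hν T
  have hV : IsSmoothSpaceTimeOn (Ioo 0 T) fun t x => w t x - e t x := hcl.smooth_velocity.sub he
  have hI : Icc a b ⊆ Ioo 0 T := fun t ht => ⟨ha.trans_le ht.1, ht.2.trans_lt hbT⟩
  have haS : a ∈ Ioo 0 T := hI (left_mem_Icc.2 hab)
  have hbS : b ∈ Ioo 0 T := hI (right_mem_Icc.2 hab)
  -- integrability of the cut-off slices
  have hslice_int : ∀ R : ℝ, 0 < R → ∀ τ ∈ Ioo 0 T, Integrable (fun x =>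
      cutoff R x ^ 2 * frobeniusNormSq (fderiv ℝ (fun y => w τ y - e τ y) x)) volume := by
    intro R hR τ hτ
    have hc : Continuous fun x => frobeniusNormSq (fderiv ℝ (fun y => w τ y - e τ y) x) :=
      continuous_frobeniusNormSq_fderiv (hV.contDiff_slice hτ) (by simp)
    exact (((contDiff_cutoff (n := 1) R).continuous.pow 2).mul hc).integrable_of_hasCompactSupport
      ((hasCompactSupport_cutoff_sq hR).mul_right)
  have hsq_int : ∀ R : ℝ, 0 < R → ∀ τ ∈ Ioo 0 T, Integrable (fun x =>
      cutoff R x ^ 2 * ‖w τ x - e τ x‖ ^ 2) volume := by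
    intro R hR τ hτ
    have hc : Continuous fun x => ‖w τ x - e τ x‖ ^ 2 := ((hV.contDiff_slice hτ).continuous.norm).pow 2
    exact (((contDiff_cutoff (n := 1) R).continuous.pow 2).mul hc).integrable_of_hasCompactSupport
      ((hasCompactSupport_cutoff_sq hR).mul_right)
  have hpow2 : ∀ y : EuclideanSpace ℝ (Fin 3), ‖y‖ₑ ^ 2 = ENNReal.ofReal (‖y‖ ^ 2) := fun y => by
    rw [← ofReal_norm, ENNReal.ofReal_pow (norm_nonneg _)]
  have hpow4 : ∀ y : EuclideanSpace ℝ (Fin 3), ‖y‖ₑ ^ 4 = ENNReal.ofReal (‖y‖ ^ 4) := fun y => by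
    rw [← ofReal_norm, ENNReal.ofReal_pow (norm_nonneg _)]
  -- the abbreviations
  set Ya : ℝ≥0∞ := ∫⁻ x, ‖w a x - e a x‖ₑ ^ 2 with hYa
  set E4 : ℝ≥0∞ := ∫⁻ τ in Ioo a b, ∫⁻ x, ‖e τ x‖ₑ ^ 4 with hE4
  set f : ℕ → EuclideanSpace ℝ (Fin 3) → ℝ≥0∞ := fun n x =>
    ENNReal.ofReal (cutoff ((n : ℝ) + 1) x ^ 2 * ‖w b x - e b x‖ ^ 2) with hf
  set g : ℕ → ℝ → ℝ≥0∞ := fun n τ => ∫⁻ x,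
    ENNReal.ofReal (cutoff ((n : ℝ) + 1) x ^ 2 * frobeniusNormSq (fderiv ℝ (fun y => w τ y - e τ y) x)) with hg
  have hg_eq : ∀ n : ℕ, ∀ τ ∈ Ioo 0 T, g n τ = ENNReal.ofReal (∫ x,
      cutoff ((n : ℝ) + 1) x ^ 2 * frobeniusNormSq (fderiv ℝ (fun y => w τ y - e τ y) x)) := by
    intro n τ hτ
    exact (ofReal_integral_eq_lintegral_ofReal (hslice_int _ (by positivity) τ hτ)
      (ae_of_all _ fun x => mul_nonneg (sq_nonneg _) (frobeniusNormSq_nonneg _))).symm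
  -- ### Step 1: the inequality for each cutoff, in `ℝ≥0∞`
  have hstep : ∀ n : ℕ, (∫⁻ x, f n x) + ENNReal.ofReal ν * ∫⁻ τ in Ioo a b, g n τ ≤
      Ya + ENNReal.ofReal (4 / ν) * E4 + ENNReal.ofReal (C / ((n : ℝ) + 1)) := by
    intro n
    have hR0 : (0 : ℝ) < (n : ℝ) + 1 := by positivity
    have hR : (1 : ℝ) ≤ (n : ℝ) + 1 := by simp
    have h := hC _ hR
    set A : ℝ := ∫ x, cutoff ((n : ℝ) + 1) x ^ 2 * ‖w b x - e b x‖ ^ 2 with hA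
    set B : ℝ := ∫ τ in Ioo a b, ∫ x,
      cutoff ((n : ℝ) + 1) x ^ 2 * frobeniusNormSq (fderiv ℝ (fun y => w τ y - e τ y) x) with hB
    set Ca : ℝ := ∫ x, cutoff ((n : ℝ) + 1) x ^ 2 * ‖w a x - e a x‖ ^ 2 with hCa
    set D : ℝ := ∫ τ in Ioo a b, ∫ x, ‖e τ x‖ ^ 4 with hD
    have hA0 : 0 ≤ A := integral_nonneg fun x => by positivity
    have hB0 : 0 ≤ B := integral_nonneg fun τ => integral_nonneg fun x =>
      mul_nonneg (sq_nonneg _) (frobeniusNormSq_nonneg _)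
    -- (i) the first term
    have hfA : ∫⁻ x, f n x = ENNReal.ofReal A := by
      rw [hA, ofReal_integral_eq_lintegral_ofReal (hsq_int _ hR0 b hbS) (ae_of_all _ fun x => by positivity)]
    -- (ii) the dissipation
    have hX : ContinuousOn (fun τ => ∫ x, cutoff ((n : ℝ) + 1) x ^ 2 *
        frobeniusNormSq (fderiv ℝ ((fun t x => w t x - e t x) τ) x)) (Icc a b) :=
      continuousOn_cutoff_dissipation hV isOpen_Ioo.uniqueDiffOn hI hR0
    have hXint : IntegrableOn (fun τ => ∫ x, cutoff ((n : ℝ) + 1) x ^ 2 *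
        frobeniusNormSq (fderiv ℝ (fun y => w τ y - e τ y) x)) (Ioo a b) volume :=
      (hX.integrableOn_compact isCompact_Icc).mono_set Ioo_subset_Icc_self
    have hgB : ∫⁻ τ in Ioo a b, g n τ = ENNReal.ofReal B := by
      rw [hB, ofReal_integral_eq_lintegral_ofReal hXint (ae_of_all _ fun τ => integral_nonneg fun x =>
        mul_nonneg (sq_nonneg _) (frobeniusNormSq_nonneg _))]
      exact setLIntegral_congr_fun measurableSet_Ioo fun τ hτ => hg_eq n τ (hI (Ioo_subset_Icc_self hτ))
    -- (iii) the initial term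
    have hCaY : ENNReal.ofReal Ca ≤ Ya := by
      rw [hCa, ofReal_integral_eq_lintegral_ofReal (hsq_int _ hR0 a haS) (ae_of_all _ fun x => by positivity)]
      refine lintegral_mono fun x => ?_
      rw [hpow2]
      refine ENNReal.ofReal_le_ofReal (mul_le_of_le_one_left (sq_nonneg _) ?_)
      exact pow_le_one₀ (cutoff_nonneg _ _) (cutoff_le_one _ _)
    -- (iv) the source term
    have hDE : ENNReal.ofReal (4 / ν * D) ≤ ENNReal.ofReal (4 / ν) * E4 := by
      rw [ENNReal.ofReal_mul (by positivity)]
      gcongr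
      calc ENNReal.ofReal D ≤ ∫⁻ τ in Ioo a b, ENNReal.ofReal (∫ x, ‖e τ x‖ ^ 4) :=
            ofReal_integral_le_lintegral_ofReal' (ae_of_all _ fun τ => integral_nonneg fun x => by positivity)
        _ ≤ E4 := by
            refine lintegral_mono fun τ => ?_
            refine (ofReal_integral_le_lintegral_ofReal' (ae_of_all _ fun x => by positivity)).trans_eq ?_
            exact lintegral_congr fun x => (hpow4 _).symm
    -- combine
    calc (∫⁻ x, f n x) + ENNReal.ofReal ν * ∫⁻ τ in Ioo a b, g n τ = ENNReal.ofReal (A + ν * B) := by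
          rw [hfA, hgB, ENNReal.ofReal_add hA0 (mul_nonneg hν.le hB0), ENNReal.ofReal_mul hν.le]
      _ ≤ ENNReal.ofReal (Ca + 4 / ν * D + C / ((n : ℝ) + 1)) := ENNReal.ofReal_le_ofReal h
      _ ≤ ENNReal.ofReal Ca + ENNReal.ofReal (4 / ν * D) + ENNReal.ofReal (C / ((n : ℝ) + 1)) :=
          ENNReal.ofReal_add_le.trans (add_le_add ENNReal.ofReal_add_le le_rfl)
      _ ≤ Ya + ENNReal.ofReal (4 / ν) * E4 + ENNReal.ofReal (C / ((n : ℝ) + 1)) := by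
          gcongr
  -- ### Step 2: Fatou for the energy at time `b`
  have hF1 : ∫⁻ x, ‖w b x - e b x‖ₑ ^ 2 ≤ liminf (fun n => ∫⁻ x, f n x) atTop := by
    have hcb : Continuous fun x => ‖w b x - e b x‖ ^ 2 := ((hV.contDiff_slice hbS).continuous.norm).pow 2
    have hmeas : ∀ n, AEMeasurable (f n) volume := fun n =>
      (ENNReal.continuous_ofReal.comp (((contDiff_cutoff (n := 1) ((n : ℝ) + 1)).continuous.pow 2).mul
        hcb)).measurable.aemeasurable
    have hlim : ∀ x, Tendsto (fun n => f n x) atTop (𝓝 (‖w b x - e b x‖ₑ ^ 2)) := by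
      intro x
      have h1 := ((tendsto_cutoff_natCast_add_one x).pow 2).mul_const (‖w b x - e b x‖ ^ 2)
      rw [one_pow, one_mul] at h1
      rw [hpow2]
      exact (ENNReal.continuous_ofReal.tendsto _).comp h1
    calc ∫⁻ x, ‖w b x - e b x‖ₑ ^ 2 = ∫⁻ x, liminf (fun n => f n x) atTop :=
          lintegral_congr fun x => ((hlim x).liminf_eq).symm
      _ ≤ liminf (fun n => ∫⁻ x, f n x) atTop := lintegral_liminf_le' hmeas
  -- ### Step 3: Fatou (twice) for the dissipation
  have hF2 : ∫⁻ τ in Ioo a b, ∫⁻ x, ENNReal.ofReal (frobeniusNormSq (fderiv ℝ (fun y => w τ y - e τ y) x)) ≤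
      liminf (fun n => ∫⁻ τ in Ioo a b, g n τ) atTop := by
    have hinner : ∀ τ ∈ Ioo a b, ∫⁻ x, ENNReal.ofReal (frobeniusNormSq (fderiv ℝ (fun y => w τ y - e τ y) x)) ≤
        liminf (fun n => g n τ) atTop := by
      intro τ hτ
      have hτS : τ ∈ Ioo 0 T := hI (Ioo_subset_Icc_self hτ)
      have hc : Continuous fun x => frobeniusNormSq (fderiv ℝ (fun y => w τ y - e τ y) x) :=
        continuous_frobeniusNormSq_fderiv (hV.contDiff_slice hτS) (by simp)
      have hmeas : ∀ n : ℕ, AEMeasurable (fun x => ENNReal.ofReal (cutoff ((n : ℝ) + 1) x ^ 2 *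
          frobeniusNormSq (fderiv ℝ (fun y => w τ y - e τ y) x))) volume := fun n =>
        (ENNReal.continuous_ofReal.comp (((contDiff_cutoff (n := 1) ((n : ℝ) + 1)).continuous.pow 2).mul
          hc)).measurable.aemeasurable
      have hlim : ∀ x, Tendsto (fun n : ℕ => ENNReal.ofReal (cutoff ((n : ℝ) + 1) x ^ 2 *
          frobeniusNormSq (fderiv ℝ (fun y => w τ y - e τ y) x))) atTop
          (𝓝 (ENNReal.ofReal (frobeniusNormSq (fderiv ℝ (fun y => w τ y - e τ y) x)))) := by
        intro x
        have h1 := ((tendsto_cutoff_natCast_add_one x).pow 2).mul_const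
          (frobeniusNormSq (fderiv ℝ (fun y => w τ y - e τ y) x))
        rw [one_pow, one_mul] at h1
        exact (ENNReal.continuous_ofReal.tendsto _).comp h1
      calc ∫⁻ x, ENNReal.ofReal (frobeniusNormSq (fderiv ℝ (fun y => w τ y - e τ y) x))
          = ∫⁻ x, liminf (fun n : ℕ => ENNReal.ofReal (cutoff ((n : ℝ) + 1) x ^ 2 *
              frobeniusNormSq (fderiv ℝ (fun y => w τ y - e τ y) x))) atTop :=
            lintegral_congr fun x => ((hlim x).liminf_eq).symm
        _ ≤ liminf (fun n => g n τ) atTop := lintegral_liminf_le' hmeas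
    have hgmeas : ∀ n, AEMeasurable (g n) ((volume : Measure ℝ).restrict (Ioo a b)) := by
      intro n
      have hR0 : (0 : ℝ) < (n : ℝ) + 1 := by positivity
      have hX : ContinuousOn (fun τ => ∫ x, cutoff ((n : ℝ) + 1) x ^ 2 *
          frobeniusNormSq (fderiv ℝ ((fun t x => w t x - e t x) τ) x)) (Icc a b) :=
        continuousOn_cutoff_dissipation hV isOpen_Ioo.uniqueDiffOn hI hR0
      have hXm : AEMeasurable (fun τ => ENNReal.ofReal (∫ x, cutoff ((n : ℝ) + 1) x ^ 2 *
          frobeniusNormSq (fderiv ℝ (fun y => w τ y - e τ y) x))) ((volume : Measure ℝ).restrict (Ioo a b)) :=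
        ((hX.mono Ioo_subset_Icc_self).aemeasurable measurableSet_Ioo).ennreal_ofReal
      refine hXm.congr ?_
      filter_upwards [ae_restrict_mem measurableSet_Ioo] with τ hτ
      exact (hg_eq n τ (hI (Ioo_subset_Icc_self hτ))).symm
    calc ∫⁻ τ in Ioo a b, ∫⁻ x, ENNReal.ofReal (frobeniusNormSq (fderiv ℝ (fun y => w τ y - e τ y) x))
        ≤ ∫⁻ τ in Ioo a b, liminf (fun n => g n τ) atTop := setLIntegral_mono' measurableSet_Ioo hinner
      _ ≤ liminf (fun n => ∫⁻ τ in Ioo a b, g n τ) atTop := lintegral_liminf_le' hgmeas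
  -- ### Step 4: pass to the limit
  have hRHS : Tendsto (fun n : ℕ => Ya + ENNReal.ofReal (4 / ν) * E4 + ENNReal.ofReal (C / ((n : ℝ) + 1)))
      atTop (𝓝 (Ya + ENNReal.ofReal (4 / ν) * E4)) := by
    have h1 : Tendsto (fun n : ℕ => C / ((n : ℝ) + 1)) atTop (𝓝 0) :=
      tendsto_const_nhds.div_atTop (tendsto_natCast_atTop_atTop.atTop_add tendsto_const_nhds)
    have h2 : Tendsto (fun n : ℕ => ENNReal.ofReal (C / ((n : ℝ) + 1))) atTop (𝓝 0) := by
      have h := (ENNReal.continuous_ofReal.tendsto 0).comp h1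
      rwa [ENNReal.ofReal_zero] at h
    have h3 := (tendsto_const_nhds (x := Ya + ENNReal.ofReal (4 / ν) * E4)).add h2
    rwa [add_zero] at h3
  calc (∫⁻ x, ‖w b x - e b x‖ₑ ^ 2) + ENNReal.ofReal ν *
        ∫⁻ τ in Ioo a b, ∫⁻ x, ENNReal.ofReal (frobeniusNormSq (fderiv ℝ (fun y => w τ y - e τ y) x))
      ≤ liminf (fun n => ∫⁻ x, f n x) atTop +
          ENNReal.ofReal ν * liminf (fun n => ∫⁻ τ in Ioo a b, g n τ) atTop :=
        add_le_add hF1 (mul_le_mul' le_rfl hF2)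
    _ = liminf (fun n => ∫⁻ x, f n x) atTop +
          liminf (fun n => ENNReal.ofReal ν * ∫⁻ τ in Ioo a b, g n τ) atTop := by
        rw [ENNReal.liminf_const_mul_of_ne_top ENNReal.ofReal_ne_top]
    _ ≤ liminf (fun n => (∫⁻ x, f n x) + ENNReal.ofReal ν * ∫⁻ τ in Ioo a b, g n τ) atTop :=
        liminf_add_liminf_le_liminf_add _ _
    _ ≤ liminf (fun n : ℕ => Ya + ENNReal.ofReal (4 / ν) * E4 + ENNReal.ofReal (C / ((n : ℝ) + 1))) atTop :=
        liminf_le_liminf (Eventually.of_forall hstep)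
    _ = Ya + ENNReal.ofReal (4 / ν) * E4 := hRHS.liminf_eq

end Kato

end GIP2003

end Literature.Analysis.FluidPDE

end
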